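import Mathlib.Tactic.Linarith
import Mathlib.Tactic.Ring
import Mathlib.Tactic.NormNum
import HarnessLib

/-!
# The (0,1) cell of the ι-window, EXISTENCE side, X: the `j = 2` sub-row at the node parameter —
# arithmetic skeleton of `H2-EXISTENCE-SIDE-10.md`

Family `hodge`, b2b cell `hweil`, `Summits/HodgeConjecture/HodgeConjecture/Theorems` (helper of item stmt-HodgeConjecture-2524, the
Weil-sixfold rung the H2 test serves). Companion to `WeilTypeLadderH2W2CornerEight.lean` ([VIII]) and `WeilTypeLadderH2W2CornerNine.lean` ([IX]) with the
SAME dictionary: `X = J(C)`, `C` general of genus `4`, `ι = −1`, `Θ = W₃ − κ` with nodes `±n`, `D_n = Θ_n ∪ Θ_{−n}`, `S_n = C − C` with vertex `0`, the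
saturated `j = 2` corner sheaves `F̂_{z₁}` of [VIII] 5.1 (pinching curve `Z₁ = z₁ − C`, deficit `ℓ′ = 4`), their vertex module `M⁽²⁾ = F̂_{z₁,0}` over
`R = k[[x,y,z,w]]` (ι-linear coordinates), the junk `T₁ = F̂/F` of a candidate `F` (Mukai vector `(0,0,0,2,4)`: a curve part of `θ`-degree `8` carried by
`Y = A ∪ ιA`, `A` a `±C`-translate in `Θ_n`, plus a `0`-dimensional part of length `ℓ₀` at the vertex), and the incidence numbers `x_A = |A ∩ X_p|`,
`e_A = |A ∩ Z₁|`, `r` = gluing length at `A ∩ ιA`. Report `run/shared/lean/b2b/hodge-weil/b2b-hweil-pv3-g17/H2-EXISTENCE-SIDE-10.md`, CLAIM TABLE v45 (LADDER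
C288) row pv3-g17. Def-free, fully proved ELEMENTARY statements (integer bookkeeping); the sheaf / module theory is in the docstrings and the report. HONEST
FRAMING: census / structure results about one cell of the ladder's H2 test on the existence side, on the Jacobian locus only; no case of the Hodge conjecture is
proved; nothing here is a rung; no statement of [Markman 2025] is used; nothing here depends on (LP) or on 'ker ob = ann(ch)'.

§1 (QT) ON THE EXISTENCE SIDE: `Hom_J(F, F̂) = k` (S₂) ⇒ `e₁^ι(F) ≥ hom^ι(F, F″/F)` for every `F ⊂ F″ ⊂ F̂`; junk off the vertex kills; socle / Tor bounds
(`socle_tor_bounds_j2`). §2 CARRIERS OFF THE VERTEX: the pure part of the junk is unique, `ℓ₀ = 2x_A + 2e_A + r − 6 ∈ {0,2,4}` (`deficit_off_vertex`,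
`strata_off_vertex`), two dead families of numerically admissible sheaves (`two_families_chi`), `[W₂]·[m₂(W₂)] = 96` (`intersection_count_96`). §3 THE VERTEX
MODULE `M⁽²⁾`: extension of `𝒪_D·f_v` (odd) by a record-shaped `M_u`; signed Betti bookkeeping (`vertex_module_betti_j2`); colength-2 census `tan ≥ 2`
(`colength_two_census_j2`); colength 4 partial (`colength_four_partial`). §4 CARRIERS THROUGH THE VERTEX = boundary triples `(z₁, c, c)` of the `j = 0` family,
`ℓ₀ = 2e₀ + r₀` (`boundary_triple_deficit`). §5 (R0) re-scoped (`R0_rescoped`). The Mukai-vector bookkeeping of the row: `j2_row_mukai_vectors`.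

What is NOT here: sheaves, `ψ`, the family mechanism, Quot schemes, the machine checks (`code/pv3-g17/numerics10.py`). 0 unconditional rungs above the floor.
-/

set_option linter.dupNamespace false

namespace Summit.HodgeConjecture.HodgeConjecture.WeilTypeLadder

section H2W2CornerTen

/-- §2.1 (report): Mukai vectors of the `j = 2` row in the basis `e_k = θ^k/k!` (`θ⁴ = 24`). `v(F̂_{z₁}) = (0,2,2,2,2)` ([VI] 2.1 with `j = 2`, `ℓ′ = 4`:
last two entries `j` and `ℓ′ − 2`), `v(T₁) = (0,0,0,2,4)`, so `v(F) = v(F̂) − v(T₁) = (0,2,2,0,−2) = 2w₀` entrywise; `χ(T₁(mΘ)) = C(4,3)·2·m + 4 = 8m + 4`; the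
`θ`-degree of the curve part is `4·v₃ = 8`; `χ(F̂) = 2`, `ℓ′ = 2 + χ(F̂) = 4`; and for the pure part `T^Y` with `χ(T^Y) = 4 − ℓ₀` the kernel `F^Y` has
`v₄(F^Y) = 2 − (4 − ℓ₀) = ℓ₀ − 2`, which is `0` for `ℓ₀ = 2` (the Mukai vector `(0,2,2,0,0)` of a `j = 0` graph sheaf with `ℓ′ = 2`, THEOREM 4.2 (c)) and `2`
for `ℓ₀ = 4` (the record value `ℓ′ = 4`). The Euler pairing `χ(F̂, T₁) = −(2·2)·(θ·θ³/6) = −4·4 = −16` (only the `(1,3)` term survives). [§2.1, §4.2; machine A1–A7] -/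
theorem j2_row_mukai_vectors :
    ((0 : ℤ) - 0 = 0 ∧ (2 : ℤ) - 0 = 2 ∧ (2 : ℤ) - 0 = 2 ∧ (2 : ℤ) - 2 = 0 ∧ (2 : ℤ) - 4 = -2) ∧
    (∀ m : ℤ, 4 * 2 * m + 4 = 8 * m + 4) ∧ ((4 : ℤ) * 2 = 8) ∧ ((2 : ℤ) + 2 = 4) ∧
    ((2 : ℤ) - (4 - 2) = 0 ∧ (2 : ℤ) - (4 - 4) = 2 ∧ ∀ l0 : ℤ, 2 - (4 - l0) = l0 - 2) ∧
    (-((2 : ℤ) * 2) * (24 / 6) = -16) := by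
  refine ⟨by norm_num, fun m => by ring, by norm_num, by norm_num, ⟨by norm_num, by norm_num, fun l0 => by ring⟩, by norm_num⟩

/-- THEOREM 2.4 (report): the deficit at the vertex for a carrier `A ⊄ S_n`. With `Θ·A = 4`, `deg L_A = 8 − x_A`, `V_A = L_A(−(A ∩ Z₁))` of degree
`8 − x_A − e_A`, genus `4` (`χ = deg − 3`), `χ(T^Y) = 2χ(V_A) − r` and `χ(T₁) = 4`, the length of the vertex junk is
`ℓ₀ = 4 − (2(8 − x_A − e_A − 3) − r) = 2x_A + 2e_A + r − 6`; for `A⁺ = C + D − h` (`x_A = 1 + ν`, `ν = [g − h ∈ A]`) this is `2ν + 2e_A + r − 4`, for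
`A⁻ = g − D′ − C` (`x_A = 3`) it is `2e_A + r`. [§2.4 (a); machine B1–B3] -/
theorem deficit_off_vertex (x e r nu : ℤ) :
    (4 - (2 * (8 - x - e - 3) - r) = 2 * x + 2 * e + r - 6) ∧
    (4 - (2 * (8 - (1 + nu) - e - 3) - r) = 2 * nu + 2 * e + r - 4) ∧
    (4 - (2 * (8 - 3 - e - 3) - r) = 2 * e + r) := by
  refine ⟨by ring, by ring, by ring⟩

/-- TABLE 2.5 (report): the incidence numbers take only the values `ν ∈ {0,1}`, `e_{A⁺} ∈ {0,2}` (a fibre of the degree-`2` addition map `C × C → W₂`),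
`e_{A⁻} ∈ {0,1}` (a fibre of the birational difference map `C × C → C − C`), `r ∈ {0,2}` (one transversal `ι`-orbit or none). Hence `ℓ₀` is EVEN (balanced
vertex junk) and lies in `{0,2,4}` whenever it is `≥ 0`; for `A⁺` the triples `(ν,e,r)` with `ℓ₀ ≥ 0` are exactly `(0,2,0) ↦ 0`, `(0,2,2) ↦ 2`, `(1,0,2) ↦ 0`,
`(1,2,0) ↦ 2`, `(1,2,2) ↦ 4`, while `(0,0,0) ↦ −4`, `(0,0,2) ↦ −2`, `(1,0,0) ↦ −2` carry NO candidate; for `A⁻`: `(0,0) ↦ 0`, `(0,2) ↦ 2`, `(1,0) ↦ 2`,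
`(1,2) ↦ 4`. [§2.5; machine B4–B7] -/
theorem strata_off_vertex :
    (∀ nu e r : ℤ, (nu = 0 ∨ nu = 1) → (e = 0 ∨ e = 2) → (r = 0 ∨ r = 2) →
      (2 * nu + 2 * e + r - 4) % 2 = 0 ∧ 2 * nu + 2 * e + r - 4 ≤ 4) ∧
    (∀ e r : ℤ, (e = 0 ∨ e = 1) → (r = 0 ∨ r = 2) → (2 * e + r) % 2 = 0 ∧ 0 ≤ 2 * e + r ∧ 2 * e + r ≤ 4) ∧
    ((2 : ℤ) * 0 + 2 * 2 + 0 - 4 = 0 ∧ (2 : ℤ) * 0 + 2 * 2 + 2 - 4 = 2 ∧ (2 : ℤ) * 1 + 2 * 0 + 2 - 4 = 0 ∧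
      (2 : ℤ) * 1 + 2 * 2 + 0 - 4 = 2 ∧ (2 : ℤ) * 1 + 2 * 2 + 2 - 4 = 4) ∧
    ((2 : ℤ) * 0 + 2 * 0 + 0 - 4 < 0 ∧ (2 : ℤ) * 0 + 2 * 0 + 2 - 4 < 0 ∧ (2 : ℤ) * 1 + 2 * 0 + 0 - 4 < 0) ∧
    ((2 : ℤ) * 0 + 0 = 0 ∧ (2 : ℤ) * 0 + 2 = 2 ∧ (2 : ℤ) * 1 + 0 = 2 ∧ (2 : ℤ) * 1 + 2 = 4) := by
  refine ⟨?_, ?_, by norm_num, by norm_num, by norm_num⟩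
  · intro nu e r hnu he hr
    rcases hnu with rfl | rfl <;> rcases he with rfl | rfl <;> rcases hr with rfl | rfl <;> norm_num
  · intro e r he hr
    rcases he with rfl | rfl <;> rcases hr with rfl | rfl <;> norm_num

/-- BY-PRODUCT 2.6 (report): the two families of NUMERICALLY ADMISSIBLE sheaves. `𝔉⁻` (carrier `A⁻` general: `x = 3`, `e = r = 0`, `deg V_A = 5`,
`χ(T^Y) = 2·(5 − 3) = 4`, so `ℓ₀ = 0`) has `dim = 1 + 2 = 3` parameters `(z₁, D′)`; `𝔉⁺` (carrier `A⁺_{z₁+d}`: `x = 1`, `e = 2`, `deg L_A = 7`,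
`deg V_A = 7 − 2 = 5`, `χ = 4`) has `1 + 1 = 2` parameters `(z₁, d)`. Both consist of simple `ι`-sheaves with `v = 2w₀` and all local indices `0`, and the
family mechanism gives `e₁^ι ≥ 3` resp. `≥ 2 > 1` — not H2 objects. [§2.6; machine B8] -/
theorem two_families_chi :
    ((8 : ℤ) - 3 - 0 = 5 ∧ 2 * ((5 : ℤ) - 3) - 0 = 4 ∧ (1 : ℤ) + 2 = 3) ∧
    ((8 : ℤ) - 1 = 7 ∧ (7 : ℤ) - 2 = 5 ∧ 2 * ((5 : ℤ) - 3) - 0 = 4 ∧ (1 : ℤ) + 1 = 2) ∧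
    ((3 : ℤ) > 1 ∧ (2 : ℤ) > 1) := by
  norm_num

/-- §2.5 (report): the sets `Σ^± = {D ∈ C₂ : 2h − 2D ∈ W₂}` are finite in general position: in `Pic²(C)` one has `[W₂] = θ²/2`, `[W₂]² = θ⁴/4 = 24/4 = 6`,
`m₂^*θ² = 2⁴θ² = 16θ²` so `m_{2*}θ² = (256/16)θ² = 16θ²` and `[m₂(W₂)] = 16[W₂]` (the map is generically injective on `W₂`); hence
`[W₂]·[m₂(W₂)] = 16·6 = 96`. Also `Θ·[C] = θ⁴/3! = 4`, `deg N_{A/J} = 6`, `deg N_{A/Θ_n} = 6 − 4 = 2`, `χ(N_{A/Θ_n}) = 2 + 2(1 − 4) = −4`. (The set `𝔇 = {d ∈ C :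
2d − 2(g − h) ∈ W₂}` has expected dimension `1 + 2 − 4 = −1`; its emptiness is the hypothesis (GP17).) [§2.5; machine C1–C3] -/
theorem intersection_count_96 :
    ((24 : ℤ) / 4 = 6) ∧ ((2 : ℤ) ^ 4 = 16 ∧ (256 : ℤ) / 16 = 16) ∧ ((16 : ℤ) * 6 = 96) ∧
    ((24 : ℤ) / 6 = 4 ∧ (6 : ℤ) - 4 = 2 ∧ (2 : ℤ) + 2 * (1 - 4) = -4) ∧ ((1 : ℤ) + 2 - 4 = -1) := by
  norm_num

/-- PROPOSITION 3.4 (report): signed Betti bookkeeping of the `j = 2` vertex module. `M_u` (record shape, [IX] 2.3): generators `(2₊,1₋)`, relations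
`(2₊,2₋)`, one second syzygy `(0₊,1₋)`; `𝒪_{R_u}·f̄_v` (Koszul on two odd and one even equation, times an odd generator): `(0₊,1₋; 2₊,1₋; 2₊,1₋; 0₊,1₋)`; the
pinched module `N₁ = 𝓘_{Γ₄}` (graded, [IX] §C, signs by the rule `−ε(−1)^j`): `(1₊,1₋; 3₊,2₋; 2₊,1₋)`. Torsion modules have vanishing SIGNED Euler
characteristics, which all three satisfy; and the extension `0 → M_u → M⁽²⁾ → 𝒪_D f̄_v → 0` with connecting ranks `i ∈ {1,2}` (onto `B̄′` on the odd side)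
and `c₂^± ≤ (2,1)` gives `β(M⁽²⁾) = (3−i, 1; 5−i−c₂⁺, 2−c₂⁻; 2−c₂⁺, 1−c₂⁻)`, again with vanishing signed Euler characteristics, `β₀⁻ = 1` and
`β₁⁻ ≤ 2`, `μ(M⁽²⁾) = 4 − i ∈ {2,3}`. [§3.4; machine E1–E3] -/
theorem vertex_module_betti_j2 :
    ((2 : ℤ) - 2 + 0 = 0 ∧ (1 : ℤ) - 2 + 1 = 0) ∧
    ((0 : ℤ) - 2 + 2 - 0 = 0 ∧ (1 : ℤ) - 1 + 1 - 1 = 0) ∧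
    ((1 : ℤ) - 3 + 2 = 0 ∧ (1 : ℤ) - 2 + 1 = 0) ∧
    (∀ i cp cm : ℤ, (3 - i) - (5 - i - cp) + (2 - cp) = 0 ∧ 1 - (2 - cm) + (1 - cm) = 0) ∧
    (∀ i cm : ℤ, (i = 1 ∨ i = 2) → (cm = 0 ∨ cm = 1) → 2 - cm ≤ 2 ∧ (4 - i = 2 ∨ 4 - i = 3)) := by
  refine ⟨by norm_num, by norm_num, by norm_num, fun i cp cm => ⟨by ring, by ring⟩, ?_⟩
  intro i cm hi hcm
  rcases hi with rfl | rfl <;> rcases hcm with rfl | rfl <;> norm_num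

/-- LEMMA 1.3 / THEOREM 3.6 (report): the socle / Tor bounds and the colength-`2` census of `M⁽²⁾`. For `0 → N′ → M → T → 0`:
`μ_s(N′) ≥ β₀^s(M) − β₀^s(T) + β₁^s(T) − β₁^s(M)`. Koszul characters: `χ^ι(k_a,k_a) = 1 + 6 + 1 = 8`, `χ^ι(k_a,k_{−a}) = −(4 + 4) = −8`, so a balanced
`T` has `χ^ι(T,T) = 8 − 8 − 8 + 8 = 0`. Colength `2`, three cases: (α) `T = k₊ ⊕ k₋`: `tan = μ₊(N′) + μ₋(N′) = μ(N′) ≥ 2` (non-cyclicity); (β) `T` curvilinear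
with top `+` (relations: `3` odd linear forms of sign `−`, one square of sign `+`): `μ₋(N′) ≥ 1 − 0 + 3 − 2 = 2`; (γ) top `−`: `N′` lies on the projective space
`P(V₊)` of dimension `dim V₊ + 3 − r(H) ≥ (3 − i) + 3 − 2 = 4 − i ≥ 2` for `i ∈ {1,2}` (`r(H) ≤ 2` by leading forms: only `ℓ ∈ ⟨x, z⟩` solve `ℓ·mw ≡ r₂·x
(mod q)`). So `tan ≥ 2` in all cases and, by (QT), `e₁^ι ≥ 2`: no candidate with `ℓ₀ = 2`. [§1.3, §3.6; machine D1–D2, E4] -/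
theorem colength_two_census_j2 :
    ((1 : ℤ) + 6 + 1 = 8 ∧ -((4 : ℤ) + 4) = -8 ∧ (8 : ℤ) - 8 - 8 + 8 = 0) ∧
    ((1 : ℤ) - 0 + 3 - 2 = 2) ∧
    (∀ i : ℤ, (i = 1 ∨ i = 2) → (3 - i) + 3 - 2 = 4 - i ∧ 2 ≤ 4 - i) ∧
    (∀ mu : ℤ, 2 ≤ mu → 2 ≤ mu + 0) := by
  refine ⟨by norm_num, by norm_num, ?_, fun mu h => by linarith⟩
  intro i hi
  rcases hi with rfl | rfl <;> norm_num

/-- PROPOSITION 3.7 (report): what the socle / Tor bounds give in colength `4` (balanced `(2,2)`; `V = k₊^{3−i} ⊕ k₋`). With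
`μ₋(N′) ≥ 1 − β₀⁻(T) + (4β₀⁺(T) − u₋(T)) − 2` and `μ₊(N′) ≥ (3−i) − β₀⁺(T) + (4β₀⁻(T) − u₊(T)) − (5−i)`, and `tan ≥ dim soc_s(T)·μ_s(N′)`:
type V `(++−;−)`: `2·(1 − 1 + 8 − 1 − 2) = 10`; IV `(++;−−)`: `2·(1 − 0 + 8 − 2 − 2) = 10`; III `(+−;+;−)`: `1 − 1 + 4 − 0 − 2 = 2`; I `(+;−;+;−)`:
`1 − 0 + 4 − 1 − 2 = 2` — DEAD; III `(+−;−;+)`: `−2 − 1 + 4 − 0 = 1`; I `(−;+;−;+)`: `−2 − 0 + 4 − 1 = 1` — only `tan ≥ 1`; II `(+;−−;+)`: `−2 − 1 + 0 − 0 < 0`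
and II `(−;++;−)`: `1 − 1 + 0 − 0 − 2 < 0` — no bound; mixed-socle quotients die by non-cyclicity (`tan ≥ μ(N′) ≥ 2`). The sign sums of all eight layer
patterns are `0` (balanced) with total length `4`. [§3.7; machine D3–D5] -/
theorem colength_four_partial :
    ((2 : ℤ) * (1 - 1 + 8 - 1 - 2) = 10 ∧ (2 : ℤ) * (1 - 0 + 8 - 2 - 2) = 10 ∧ (1 : ℤ) - 1 + 4 - 0 - 2 = 2 ∧ (1 : ℤ) - 0 + 4 - 1 - 2 = 2) ∧
    ((-2 : ℤ) - 1 + 4 - 0 = 1 ∧ (-2 : ℤ) - 0 + 4 - 1 = 1) ∧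
    ((-2 : ℤ) - 1 + 0 - 0 < 0 ∧ (1 : ℤ) - 1 + 0 - 0 - 2 < 0) ∧
    ((1 : ℤ) + 1 - 1 - 1 = 0 ∧ (1 : ℤ) + 1 - 1 - 1 = 0 ∧ (1 : ℤ) - 1 + 1 - 1 = 0 ∧ (1 : ℤ) - 1 - 1 + 1 = 0 ∧
      (-1 : ℤ) + 1 + 1 - 1 = 0 ∧ (1 : ℤ) - 1 + 1 - 1 = 0 ∧ (-1 : ℤ) + 1 - 1 + 1 = 0 ∧ (3 : ℤ) + 1 = 4 ∧ (2 : ℤ) + 2 = 4 ∧ (2 : ℤ) + 1 + 1 = 4 ∧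
      (1 : ℤ) + 2 + 1 = 4 ∧ (1 : ℤ) + 1 + 1 + 1 = 4) := by
  norm_num

/-- PROPOSITION 4.3 / THEOREM 4.5 (report): the carriers through the vertex `Y_c = (c − C) ∪ (C − c)`, `c ≠ z₁`. Here `deg L_A = 8 − 3 = 5`, `V_A = L_A(−e₀·0)`,
`χ(T^Y) = 2(2 − e₀) − r₀`, so `ℓ₀ = 4 − χ(T^Y) = 2e₀ + r₀`, and the signed length of the vertex junk is `signed(R) + (e₀, e₀)`. The branch computation gives
`(e₀, r₀) = (0, 2)` for `c ∉ g_{z₁}` (`ℓ₀ = 2`, `R` balanced `(1,1)`, junk `(1,1)`), `(1, 0)` for `c ∈ g_{z₁} − z₁` with `z₁ + 2c ∉ |g|` (`ℓ₀ = 2`, junk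
`(0,0) + (1,1) = (1,1)`), and `(1, 2)` on the record boundary `z₁ + 2c ∈ |g|` (`ℓ₀ = 4`, junk `(1,1) + (1,1) = (2,2)`) — so the candidates are the balanced
colength-`2` (resp. `4`) quotients of the vertex module of the boundary triple `(z₁, c, c)`, killed by [VIII] THEOREM 3.3 (resp. [IX] THEOREM 3.8) and (QT):
`tan ≥ 2 > 1`. The Mukai vector check `v₄(F^Y) = ℓ₀ − 2` is in `j2_row_mukai_vectors`. [§4.2–4.5; machine F1–F7] -/
theorem boundary_triple_deficit :
    ((8 : ℤ) - 3 = 5) ∧ (∀ e0 r0 : ℤ, 4 - (2 * (5 - e0 - 3) - r0) = 2 * e0 + r0) ∧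
    ((2 : ℤ) * 0 + 2 = 2 ∧ (2 : ℤ) * 1 + 0 = 2 ∧ (2 : ℤ) * 1 + 2 = 4) ∧
    (((1 : ℤ) + 0, (1 : ℤ) + 0) = (1, 1) ∧ ((0 : ℤ) + 1, (0 : ℤ) + 1) = (1, 1) ∧ ((1 : ℤ) + 1, (1 : ℤ) + 1) = (2, 2)) ∧
    ((2 : ℤ) > 1) := by
  refine ⟨by norm_num, fun e0 r0 => by ring, by norm_num, by norm_num, by norm_num⟩

/-- §5.1 (report): (R0) re-scoped with vertex junk allowed. `T^Y_A = M₁ = 𝓥₁/K` with `deg 𝓥₁ = 8` ([VIII] 9.4), `k := deg K`, `deg M₁ = 8 − k`,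
`χ(M₁) = 5 − k`, gluing `δ ≤ 2` at the vertex (the δ-invariant of the tacnode `Z₁ ∪ Z₂`), `χ(T₁) = 2(5 − k) − δ + ℓ₀ = 4`, hence `ℓ₀ = δ + 2k − 6`:
`k ≤ 1` is impossible (`ℓ₀ < 0` for every `δ ≤ 2`), `k = 2` forces `(δ, ℓ₀) = (2, 0)`, `k = 3` gives `ℓ₀ = δ ∈ {0,1,2}`, and `k ≥ 4` (special extension
class only) gives `ℓ₀ = δ + 2k − 6 ≥ 2`. The tangent count `h⁰(K^∨ ⊗ M₁) ≥ χ = (8 − 2k) − 3 = 5 − 2k` is `≥ 1` for `k = 2`. [§5.1–5.2] -/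
theorem R0_rescoped :
    (∀ k δ : ℤ, 2 * (5 - k) - δ + (δ + 2 * k - 6) = 4) ∧
    (∀ k δ : ℤ, k ≤ 1 → δ ≤ 2 → δ + 2 * k - 6 < 0) ∧
    (∀ δ : ℤ, 0 ≤ δ → δ ≤ 2 → 0 ≤ δ + 2 * 2 - 6 → δ = 2 ∧ δ + 2 * 2 - 6 = 0) ∧
    (∀ δ : ℤ, δ + 2 * 3 - 6 = δ) ∧
    (∀ k δ : ℤ, 4 ≤ k → 0 ≤ δ → 2 ≤ δ + 2 * k - 6) ∧
    ((8 : ℤ) - 2 * 2 - 3 = 1 ∧ (8 : ℤ) - 2 * 3 - 3 = -1) := by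
  refine ⟨fun k δ => by ring, fun k δ hk hδ => by linarith, ?_, fun δ => by ring, fun k δ hk hδ => by linarith, by norm_num⟩
  intro δ h0 h2 h
  constructor <;> linarith

/-- ADDENDUM A, THEOREM A.2 / COROLLARY A.3 (report §A): the `j = 2` vertex module is TWO-generated. The identity `c₃|_Λ = y·a − w·b` with
`(a,b) = (κ, κ′)·m′m″` and `c₃|_Λ = λ′·m·m′m″`, `λ′ ≠ 0`, gives `λ′m = κy − κ′w`, and `κ = 0` would put `z₁` at `ℓ_p ∩ ℓ′` (excluded for `p` general), so
`κ ≠ 0`; the even element `E₀ = ũ_odd f_v − ṽ_ev f_u ∈ K ∩ 𝔪M⁽²⁾` has `E₀ ≡ ½γ₂(0)·A′ (mod 𝔪M⁽²⁾)` with `γ₂(0)·λ′ = κ`, hence `γ₂(0) ≠ 0` and `A′ ∈ 𝔪M⁽²⁾`: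
`i = 2`, `dim V₊ = 3 − i = 1`, `μ(M⁽²⁾) = 4 − i = 2`. Then `U = 𝔪M/𝔪²M` has `dim U₋ = 4` (the four `ℓf_u`, no syzygy) and `dim U₊ = 4 − 1 = 3` (the four
`ℓf_v` modulo the single syzygy `(κ′x − κz) ⊗ f_v`): `dim U = 7 = 3 + 4`, as the machine model `j2mod.py` prints for `N = 6, 7`. In `3.6 (γ)` the family
`P(V₊)` then has dimension `1 + 3 − 1 = 3 ≥ 2`. [§A.1–A.3; machine A.8] -/
theorem mu_two_j2 (κ κ' lam γ : ℤ) (hκ : κ ≠ 0) (hγ : γ * lam = κ) :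
    (γ ≠ 0 ∧ lam ≠ 0) ∧ ((3 : ℤ) - 2 = 1 ∧ (4 : ℤ) - 2 = 2) ∧ ((4 : ℤ) - 0 = 4 ∧ (4 : ℤ) - 1 = 3 ∧ (3 : ℤ) + 4 = 7) ∧
    ((1 : ℤ) + 3 - 1 = 3 ∧ (2 : ℤ) ≤ 3) ∧ (κ * 1 - κ' * 0 = κ) := by
  refine ⟨⟨?_, ?_⟩, by norm_num, by norm_num, by norm_num, by ring⟩
  · rintro rfl
    apply hκ
    rw [← hγ]
    ring
  · rintro rfl
    apply hκ
    rw [← hγ]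
    ring

/-- ADDENDUM A, THEOREM A.5 (report §A): the colength-`4` census of `M⁽²⁾` CLOSES. With `V = k₊ ⊕ k₋` the balanced `(2,2)` quotients have radical-layer
types I₊ `(+;−;+;−)`, I₋ `(−;+;−;+)`, II₊ `(+;−−;+)`, II₋ `(−;++;−)`, III₊ `(+−;−;+)`, III₋ `(+−;+;−)`, IV `(+−;+−)` — each with sign-sum `0` and length
`4` — and the tangent dimension `tan = hom^ι(N′, T)` is bounded below by: IV (mixed socle) `μ(N′) ≥ 2`; III₋, I₊: `1 − β₀⁻(T) + 4β₀⁺(T) − u₋(T) − 2 = 2`;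
II₋: the `2`-dimensional family `f_u − r f_v ↦ t₁ ∈ T₊` (`dim T₊ = 2`, relations have coefficients in `𝔪²`); II₊: `1` (kernel of `ℓ_B : T₋ → soc`, `2 − 1`)
`+ 1` (even generators of `I` minus conditions, `2 − 1`) `= 2`; III₊*: `μ₊(N′) ≥ 3` (the classes of `xf_v, yf_v, wf_v` in `U₊`); I₋: `μ₊(N′) ≥ 3 − 1 = 2`.
The minimum over the seven types is `2 > 1`, so by (QT) no candidate with `ℓ₀ = 4` survives: `(R1)_vtx⁽⁴⁾ = ∅`. [§A.5–A.6] -/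
theorem colength_four_census_j2 :
    ((1 : ℤ) - 1 + 1 - 1 = 0 ∧ (-1 : ℤ) + 1 - 1 + 1 = 0 ∧ (1 : ℤ) - 1 - 1 + 1 = 0 ∧ (-1 : ℤ) + 1 + 1 - 1 = 0 ∧
      (1 : ℤ) - 1 - 1 + 1 = 0 ∧ (1 : ℤ) - 1 + 1 - 1 = 0 ∧ (1 : ℤ) - 1 + 1 - 1 = 0) ∧
    ((1 : ℤ) - 1 + 4 * 1 - 0 - 2 = 2 ∧ (1 : ℤ) - 0 + 4 * 1 - 1 - 2 = 2) ∧
    ((2 : ℤ) - 1 + (2 - 1) = 2) ∧ ((4 : ℤ) - 1 = 3 ∧ (3 : ℤ) - 1 = 2) ∧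
    (∀ t : ℤ, t = 2 ∨ t = 3 → 2 ≤ t) ∧ ((2 : ℤ) > 1) := by
  refine ⟨by norm_num, by norm_num, by norm_num, by norm_num, ?_, by norm_num⟩
  intro t ht
  rcases ht with rfl | rfl <;> norm_num

/-- ADDENDUM A, §A.7 (report): (R0) sharpened. `𝓥₁` is free at the vertex on `(f̄_u, f̄_v)` (two generators, rank two), the quotient map sends them to a
unimodular pair `(φ₁, φ₂)`, and the vertex gluing length is `δ = 0` (both units) or `δ = 1 + 1 = 2` (exactly one non-unit: one condition on `a + b`, one on
`a − b`), never `1`; the gluing module `R` is then `k₊ ⊕ k₋` (balanced). With `ℓ₀ = δ + 2k − 6` (5.1): `k = 2 ⇒ (δ, ℓ₀) = (2, 0)`; `k = 3 ⇒ (δ, ℓ₀) ∈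
{(0,0), (2,2)}` and `(3,1,1)` is EXCLUDED; `k = 4 ⇒ ℓ₀ ∈ {2, 4}`. [§A.7] -/
theorem R0_delta_even :
    ((1 : ℤ) + 1 = 2) ∧
    (∀ δ k : ℤ, (δ = 0 ∨ δ = 2) → δ + 2 * k - 6 ≠ 1 + 2 * (k - 3)) ∧
    ((2 : ℤ) + 2 * 2 - 6 = 0 ∧ (0 : ℤ) + 2 * 3 - 6 = 0 ∧ (2 : ℤ) + 2 * 3 - 6 = 2 ∧ (0 : ℤ) + 2 * 4 - 6 = 2 ∧ (2 : ℤ) + 2 * 4 - 6 = 4) ∧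
    (∀ k : ℤ, (1 : ℤ) + 2 * k - 6 = 2 * k - 5) := by
  refine ⟨by norm_num, ?_, by norm_num, fun k => by ring⟩
  intro δ k hδ
  rcases hδ with rfl | rfl <;> omega

/-- ADDENDUM B, PROPOSITION B.1 / B.2 / B.4 (report §B): the (R0) candidate family. For `K₀ = A(−2P) ⊂ 𝓥₁` (degree `2`, quotient `B` of degree `6`,
`χ(B) = 6 − 3 = 3`) one has `K₀(0) = V₋`, hence `δ = 2` and `ℓ₀ = 2 + 2·2 − 6 = 0`, `χ(T^Y) = 2·3 − 2 = 4`: the sheaf `F^{R0}_{z₁} = ker(F̂_{z₁} ↠ T^Y_{K₀})` is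
numerically admissible for EVERY `z₁` (a `1`-parameter family, `e₁^ι ≥ 1`). [VIII] 9.5 (a)'s deformations of `K₀` number `h⁰(K₀^∨ ⊗ B) ≥ χ = (−2 + 6) − 3 = 1`,
but a deformation moving `K(0)` off `V₋` gives `δ = 0` and `ℓ₀ = 0 + 4 − 6 = −2 < 0` (not a candidate); the vertex-preserving ones live in degree
`4 − 1 = 3`, `χ = 0`. The other rows need a special extension class: `4 + 1` conditions for `k = 2`, `K(0) = V₊`; `4` conditions on `D₃ ∈ C₃` for `k = 3`.
Deciding `e₁^ι(F^{R0}_{z₁}) ∈ {1, ≥ 2}` is the (R0) question; nothing here claims an object. [§B.1–B.4] -/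
theorem R0_candidate_family :
    ((6 : ℤ) - 3 = 3 ∧ (2 : ℤ) + 2 * 2 - 6 = 0 ∧ (2 : ℤ) * 3 - 2 = 4) ∧
    ((-2 : ℤ) + 6 = 4 ∧ (4 : ℤ) - 3 = 1 ∧ (0 : ℤ) + 2 * 2 - 6 < 0 ∧ (4 : ℤ) - 1 = 3 ∧ (3 : ℤ) - 3 = 0) ∧
    ((4 : ℤ) + 1 = 5 ∧ (1 : ℤ) ≤ 1) := by
  norm_num

end H2W2CornerTen

section H2W2CornerTenScope

/-- SCOPE of `colength_four_census_j2` / [X] THEOREM A.5 (ii) and COROLLARY A.6 (referee-g89, W-P3g17-A5-a; recorded here by pv3-g18, not in place):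
A.5 (ii) (type II₊) uses A.4 (c), which rests on 3.3 and hence on the hypothesis '`z₁` is not a ramification point of `π_g`' (the ι-invariance of the
residual curve `R_u`); so A.5 / A.6 ('(R1)_vtx⁽⁴⁾ = ∅') are certified FOR `z₁` UNRAMIFIED ONLY. The residual is the finite set (`z₁` one of the
`2·4 − 2 + 2·3 = 12` ramification points of the degree-`3` map `π_g`) × (carriers `A⁻_{D′}`, `D′ ∈ Σ⁻` finite with `D′ ∩ (g_{z₁} − z₁) ≠ ∅`) × (type II₊,
colength `4`), EMPTY under the general-position hypothesis (GP18) of `H2-EXISTENCE-SIDE-11.md` §5.2: no `D′ ∈ Σ⁻` contains a point of the `g`-divisor of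
a ramification point of `π_g`. The bracket of A.5 (ii) is NOT expanded. [W-P3g17-A5-a; [XI] 5.2] -/
theorem colength_four_census_j2_scope :
    (2 : ℤ) * 4 - 2 + 2 * 3 = 12 ∧ (3 : ℤ) - 1 = 2 ∧ (4 : ℤ) = 2 + 2 := by
  norm_num

end H2W2CornerTenScope

end Summit.HodgeConjecture.HodgeConjecture.WeilTypeLadder
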